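import Summits.QuantumFields.YangMills.Theorems.BalabanLadderNTCanonicalEnvelopes
import HarnessLib

/-!
# Crux `NT` (stmt-QuantumFields-19353) `BalabanLadder.NT`: the clause-(i)/(ii) floors IN PLAQUETTE LETTERS — some charged
# pair carries an `n⁸`-law floor with a β-UNIFORM constant at lattice distances `n ≍ δ/a(β)`, and conversely for bumps

Helper file (`--supports stmt-QuantumFields-19353`) of the fleet lead prover of crux `NT` (unit `ym-spine-19353-p1`, GEN 13).
Hypothesis-free, general compact `G`, any `r`; a reading of the crux's own conclusion `LowerBounds` (no engine clause).

`Q2_{β,L,s}(θv, v) = ΣΣ θv(s x) v(s y) Cov_T(A_x, A_y)` is a finite signed average of plaquette–plaquette covariances over the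
pairs CHARGED by the two witnesses.  Hence (pigeonhole on the finitely many charged pairs, GEN 12's
`CeilingPrice.abs_Q2_le_of_pointwise` read contrapositively):

* §1 `exists_charged_pair_of_le_Q2` — `0 < ε ≤ Q2_{β,L,s}(f, g)` ⇒ some charged pair has `ε ≤ S_f S_g · |Cov_T(A_x, A_y)|`;
  `exists_charged_triple_of_le_absQ3` — the clause-(ii) twin with `|κ₃,T(x,y,z)|`.
* §2 witness geometry for the reflection pair (`v` with time gap `δ`, support in the ball of radius `σ`): charged pairs have
  lattice separation `n = ‖y − x‖ ∈ [2δ/s, 2σ/s]`; **`n8_floor_of_le_Q2`**: `ε·(2δ)⁸ ≤ (s⁴S_θ)(s⁴S_v) · n⁸|Cov_T(A_x, A_y)|`.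
* §3 **`n8_floor_of_q2Floor`** — along a unit map `a > 0`, `a → 0` carrying the plain clause-(i) floor on all large tori
  (the `LowerBounds` shape): for every `K > ‖v‖₁²` and all large `β`, on EVERY torus `2L+1` with `max(Λ₅, σ) ≤ a(β)·L` there
  is a plaquette pair at lattice distance `n ∈ [2δ/a(β), 2σ/a(β)]` with **`n⁸ · |Cov_T(A_x, A_y)| ≥ ε(2δ)⁸/K`** — the
  `1/n⁸` law of the action-density two-point function with a coefficient that does NOT vanish as `β → ∞`, at lattice
  distances `n ≍ δ/a(β) → ∞`.  (Fixed-order lattice perturbation theory gives `n⁸ Cov_T → O(β⁻²)`: the floor is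
  dimensional transmutation, barrier `PerturbativeInvisibility`; the IR desk's AF window `SharpLanes.CovWindowAt` is the
  negation of exactly this at scales below `ℓ(β)`, cf. `AfPincerUc.afBelowScale_of_covarianceAF`.)
* §4 the converse for BUMPS: **`q2Floor_of_pointwise_floor`** — if `v ≥ 0` (`‖v‖₁ > 0`) and every pair charged by `θv, v`
  has `Cov_T(A_x, A_y) ≥ c·a(β)⁸` (`c > 0`) on all large tori for all large `β`, then clause (i) holds with
  `ε = c‖v‖₁²/2`: up to the one-pair/all-pairs gap, clause (i) of `NT` IS a β-uniform `a⁸`-floor (equivalently an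
  `n⁸`-law floor at `n ≍ 1/a`) on the plaquette two-point function over a cloud of pairs.

HONEST FRAMING.  Finite bookkeeping and Riemann sums over tree theorems; a reading of the crux statement, nothing about its
truth; no floor, not AF, not NT, not the seam, not the gap; not Clay.
-/

set_option autoImplicit false

noncomputable section

open scoped SchwartzMap
open MeasureTheory Filter Topology
open Literature.MathematicalPhysics.QuantumFieldTheory Literature.MathematicalPhysics.QuantumLattice
open Literature.Probability.LatticeModels
open Summit.QuantumFields.YangMills.Cruxes.OSLegsFromFemtoAndGap.DlrCollarTransfer
open Summit.QuantumFields.YangMills.Theorems.OSLegsFromFemtoAndGap (siteToE_sub)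
open Summit.QuantumFields.YangMills.Cruxes.NT.Reference
  (smul_siteToE_apply_zero norm_siteToE_le_of_apply_ne_zero tsupport_thetaTest_subset_closedBall_zero)

namespace Summit.QuantumFields.YangMills.Cruxes.NT.PointwiseFloor

/-! ## §1 Pigeonhole: a smeared floor charges one pair (triple) -/

section Pigeonhole

variable (G : Type) [Group G] [TopologicalSpace G] [IsTopologicalGroup G] [CompactSpace G]
  [MeasurableSpace G] [BorelSpace G] (r : LatticeRep G)

/-- **A two-point floor charges one pair.**  If `0 < ε ≤ Q2_{β,L,s}(f, g)` then some pair `x, y ∈ box L` charged by `f, g`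
(`f(s x) ≠ 0`, `g(s y) ≠ 0`) has `ε ≤ S_f · S_g · |Cov_T(A_x, A_y)|` (`S_f = Σ|f(s x)|`). [folklore] -/
theorem exists_charged_pair_of_le_Q2 (β : ℝ) (L : ℕ) (s : ℝ) (f g : 𝓢(EuclideanSpace ℝ (Fin 4), ℝ)) {ε : ℝ}
    (hε : 0 < ε) (hfloor : ε ≤ Q2 G r β L s f g) :
    ∃ x ∈ box 4 L, ∃ y ∈ box 4 L, f (s • siteToE x) ≠ 0 ∧ g (s • siteToE y) ≠ 0 ∧
      ε ≤ (∑ x' ∈ box 4 L, |f (s • siteToE x')|) * (∑ y' ∈ box 4 L, |g (s • siteToE y')|) *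
        |torusE G r β L (fun U => dens G r x U * dens G r y U) - torusE G r β L (dens G r x) * torusE G r β L (dens G r y)| := by
  classical
  set T := ((box 4 L) ×ˢ (box 4 L)).filter fun p => f (s • siteToE p.1) ≠ 0 ∧ g (s • siteToE p.2) ≠ 0 with hT
  set C : (Fin 4 → ℤ) × (Fin 4 → ℤ) → ℝ := fun p =>
    |torusE G r β L (fun U => dens G r p.1 U * dens G r p.2 U) - torusE G r β L (dens G r p.1) * torusE G r β L (dens G r p.2)|
    with hC
  by_cases hne : T.Nonempty
  · obtain ⟨p, hp, hmax⟩ := T.exists_max_image C hne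
    have hp' := Finset.mem_filter.1 hp
    have hpb := Finset.mem_product.1 hp'.1
    refine ⟨p.1, hpb.1, p.2, hpb.2, hp'.2.1, hp'.2.2, hfloor.trans ((le_abs_self _).trans ?_)⟩
    refine CeilingPrice.abs_Q2_le_of_pointwise G r β L s f g fun x hx y hy hfx hgy => ?_
    exact hmax (x, y) (Finset.mem_filter.2 ⟨Finset.mem_product.2 ⟨hx, hy⟩, hfx, hgy⟩)
  · exfalso
    have h0 := CeilingPrice.abs_Q2_le_of_pointwise G r β L s f g (B := 0) fun x hx y hy hfx hgy =>
      (hne ⟨(x, y), Finset.mem_filter.2 ⟨Finset.mem_product.2 ⟨hx, hy⟩, hfx, hgy⟩⟩).elim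
    rw [mul_zero] at h0
    linarith [le_abs_self (Q2 G r β L s f g)]

/-- **A three-point floor charges one triple.**  If `0 < ε ≤ |Q3_{β,L,s}(f, g, h)|` then some charged triple has
`ε ≤ S_f S_g S_h · |κ₃,T(x, y, z)|`. [folklore] -/
theorem exists_charged_triple_of_le_absQ3 (β : ℝ) (L : ℕ) (s : ℝ) (f g h : 𝓢(EuclideanSpace ℝ (Fin 4), ℝ)) {ε : ℝ}
    (hε : 0 < ε) (hfloor : ε ≤ |Q3 G r β L s f g h|) :
    ∃ x ∈ box 4 L, ∃ y ∈ box 4 L, ∃ z ∈ box 4 L, f (s • siteToE x) ≠ 0 ∧ g (s • siteToE y) ≠ 0 ∧ h (s • siteToE z) ≠ 0 ∧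
      ε ≤ (∑ x' ∈ box 4 L, |f (s • siteToE x')|) * (∑ y' ∈ box 4 L, |g (s • siteToE y')|) *
        (∑ z' ∈ box 4 L, |h (s • siteToE z')|) * |torusK3 G r β L x y z| := by
  classical
  set T := ((box 4 L) ×ˢ ((box 4 L) ×ˢ (box 4 L))).filter fun p =>
    f (s • siteToE p.1) ≠ 0 ∧ g (s • siteToE p.2.1) ≠ 0 ∧ h (s • siteToE p.2.2) ≠ 0 with hT
  set C : (Fin 4 → ℤ) × ((Fin 4 → ℤ) × (Fin 4 → ℤ)) → ℝ := fun p => |torusK3 G r β L p.1 p.2.1 p.2.2| with hC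
  by_cases hne : T.Nonempty
  · obtain ⟨p, hp, hmax⟩ := T.exists_max_image C hne
    have hp' := Finset.mem_filter.1 hp
    have hpb := Finset.mem_product.1 hp'.1
    have hpb2 := Finset.mem_product.1 hpb.2
    refine ⟨p.1, hpb.1, p.2.1, hpb2.1, p.2.2, hpb2.2, hp'.2.1, hp'.2.2.1, hp'.2.2.2, hfloor.trans ?_⟩
    refine CeilingPrice.abs_Q3_le_of_pointwise G r β L s f g h fun x hx y hy z hz hfx hgy hhz => ?_
    exact hmax (x, (y, z)) (Finset.mem_filter.2 ⟨Finset.mem_product.2 ⟨hx, Finset.mem_product.2 ⟨hy, hz⟩⟩, hfx, hgy, hhz⟩)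
  · exfalso
    have h0 := CeilingPrice.abs_Q3_le_of_pointwise G r β L s f g h (B := 0) fun x hx y hy z hz hfx hgy hhz =>
      (hne ⟨(x, (y, z)), Finset.mem_filter.2 ⟨Finset.mem_product.2 ⟨hx, Finset.mem_product.2 ⟨hy, hz⟩⟩, hfx, hgy, hhz⟩⟩).elim
    rw [mul_zero] at h0
    linarith

end Pigeonhole

/-! ## §2 Geometry of the reflection pair; the `n⁸` law on one torus -/

section Geometry

/-- **Charged pairs of the reflection witness are time-separated by `2δ/s`.**  If `v` has time gap `δ`
(`v y ≠ 0 → δ ≤ y 0`) and `s ≥ 0`, then `θv(s x) ≠ 0`, `v(s y) ≠ 0` give `2δ ≤ s·(y 0 − x 0) ≤ s·‖y − x‖`. [folklore] -/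
theorem two_mul_timeGap_le_of_charged {v : 𝓢(EuclideanSpace ℝ (Fin 4), ℝ)} {δ s : ℝ} (hs : 0 ≤ s)
    (hvδ : ∀ y : EuclideanSpace ℝ (Fin 4), v y ≠ 0 → δ ≤ y 0) {x y : Fin 4 → ℤ}
    (hx : thetaTest 4 v (s • siteToE x) ≠ 0) (hy : v (s • siteToE y) ≠ 0) :
    2 * δ ≤ s * ((y 0 : ℝ) - (x 0 : ℝ)) ∧ 2 * δ ≤ s * ‖siteToE (y - x)‖ := by
  have hx0 : δ ≤ -(s * (x 0 : ℝ)) := by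
    rw [thetaTest_apply] at hx
    have h1 := hvδ _ hx
    have h0 : (timeReflection 4 (s • siteToE x)) 0 = -((s • siteToE x) 0) := by simp
    rwa [h0, smul_siteToE_apply_zero] at h1
  have hy0 : δ ≤ s * (y 0 : ℝ) := by
    have h2 := hvδ _ hy
    rwa [smul_siteToE_apply_zero] at h2
  have h1 : 2 * δ ≤ s * ((y 0 : ℝ) - (x 0 : ℝ)) := by linarith
  have hcoord : (y 0 : ℝ) - (x 0 : ℝ) ≤ ‖siteToE (y - x)‖ := by
    have h := PiLp.norm_apply_le (siteToE (y - x)) 0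
    rw [siteToE_apply, Pi.sub_apply, Int.cast_sub, Real.norm_eq_abs] at h
    exact (le_abs_self _).trans h
  exact ⟨h1, h1.trans (mul_le_mul_of_nonneg_left hcoord hs)⟩

/-- Charged pairs of two witnesses supported in the ball of radius `σ` are at lattice distance `≤ 2σ/s`. [folklore] -/
theorem mul_norm_le_of_charged {f g : 𝓢(EuclideanSpace ℝ (Fin 4), ℝ)} {σ s : ℝ} (hs : 0 < s)
    (hfσ : tsupport (f : EuclideanSpace ℝ (Fin 4) → ℝ) ⊆ Metric.closedBall 0 σ)
    (hgσ : tsupport (g : EuclideanSpace ℝ (Fin 4) → ℝ) ⊆ Metric.closedBall 0 σ) {x y : Fin 4 → ℤ}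
    (hx : f (s • siteToE x) ≠ 0) (hy : g (s • siteToE y) ≠ 0) : s * ‖siteToE (y - x)‖ ≤ 2 * σ := by
  have hX := norm_siteToE_le_of_apply_ne_zero hs hfσ hx
  have hY := norm_siteToE_le_of_apply_ne_zero hs hgσ hy
  have h : ‖siteToE (y - x)‖ ≤ 2 * σ / s := by
    rw [siteToE_sub]
    calc ‖siteToE y - siteToE x‖ ≤ ‖siteToE y‖ + ‖siteToE x‖ := norm_sub_le _ _
      _ ≤ σ / s + σ / s := add_le_add hY hX
      _ = 2 * σ / s := by ring
  calc s * ‖siteToE (y - x)‖ ≤ s * (2 * σ / s) := mul_le_mul_of_nonneg_left h hs.le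
    _ = 2 * σ := by field_simp

variable (G : Type) [Group G] [TopologicalSpace G] [IsTopologicalGroup G] [CompactSpace G]
  [MeasurableSpace G] [BorelSpace G] (r : LatticeRep G)

/-- **The `n⁸` law on one torus.**  If `0 < ε ≤ Q2_{β,L,s}(θv, v)` (`s > 0`) for a witness `v` with time gap `δ ≥ 0`,
then some pair `x, y ∈ box L` charged by `θv, v`, at lattice distance `n = ‖y − x‖ ≥ 2δ/s`, has
`ε·(2δ)⁸ ≤ (s⁴S_θ)(s⁴S_v) · (n⁸ · |Cov_T(A_x, A_y)|)`. [folklore] -/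
theorem n8_floor_of_le_Q2 (β : ℝ) (L : ℕ) {s : ℝ} (hs : 0 < s) {v : 𝓢(EuclideanSpace ℝ (Fin 4), ℝ)} {δ ε : ℝ}
    (hδ : 0 ≤ δ) (hvδ : ∀ y : EuclideanSpace ℝ (Fin 4), v y ≠ 0 → δ ≤ y 0) (hε : 0 < ε)
    (hfloor : ε ≤ Q2 G r β L s (thetaTest 4 v) v) :
    ∃ x ∈ box 4 L, ∃ y ∈ box 4 L, thetaTest 4 v (s • siteToE x) ≠ 0 ∧ v (s • siteToE y) ≠ 0 ∧
      2 * δ ≤ s * ‖siteToE (y - x)‖ ∧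
      ε * (2 * δ) ^ 8 ≤ (s ^ 4 * ∑ x' ∈ box 4 L, |thetaTest 4 v (s • siteToE x')|) *
        (s ^ 4 * ∑ y' ∈ box 4 L, |v (s • siteToE y')|) *
        (‖siteToE (y - x)‖ ^ 8 * |torusE G r β L (fun U => dens G r x U * dens G r y U) -
          torusE G r β L (dens G r x) * torusE G r β L (dens G r y)|) := by
  obtain ⟨x, hx, y, hy, hfx, hgy, hle⟩ := exists_charged_pair_of_le_Q2 G r β L s (thetaTest 4 v) v hε hfloor
  obtain ⟨-, hgap⟩ := two_mul_timeGap_le_of_charged hs.le hvδ hfx hgy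
  refine ⟨x, hx, y, hy, hfx, hgy, hgap, ?_⟩
  set Sθ := ∑ x' ∈ box 4 L, |thetaTest 4 v (s • siteToE x')|
  set Sv := ∑ y' ∈ box 4 L, |v (s • siteToE y')|
  set C := |torusE G r β L (fun U => dens G r x U * dens G r y U) - torusE G r β L (dens G r x) * torusE G r β L (dens G r y)|
  have hC : 0 ≤ C := abs_nonneg _
  have h28 : (2 * δ) ^ 8 ≤ (s * ‖siteToE (y - x)‖) ^ 8 := pow_le_pow_left₀ (by positivity) hgap 8
  calc ε * (2 * δ) ^ 8 ≤ (Sθ * Sv * C) * (s * ‖siteToE (y - x)‖) ^ 8 :=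
        mul_le_mul hle h28 (by positivity) ((hε.le).trans hle)
    _ = (s ^ 4 * Sθ) * (s ^ 4 * Sv) * (‖siteToE (y - x)‖ ^ 8 * C) := by ring

end Geometry

/-! ## §3 Along a unit map: the `n⁸` law with a β-uniform constant -/

section UnitMap

variable (G : Type) [Group G] [TopologicalSpace G] [IsTopologicalGroup G] [CompactSpace G]
  [MeasurableSpace G] [BorelSpace G] (r : LatticeRep G)

/-- **The clause-(i) floor in plaquette letters.**  Let `a > 0`, `a → 0` carry the plain clause-(i) floor
`ε ≤ Q2_{β,L,aβ}(θv, v)` (`ε > 0`) for `β ≥ β₅` on all tori with `Λ₅ ≤ aβ·L`, for a witness `v` with time gap `δ ≥ 0` and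
support in the ball of radius `σ`.  Then for every `K > ‖v‖₁²` there is `β₆` such that for all `β ≥ β₆` and EVERY torus with
`max Λ₅ σ ≤ aβ·L` some pair `x, y ∈ box L` charged by `θv, v` — at lattice distance `n = ‖y − x‖` with
`2δ ≤ aβ·n ≤ 2σ` — has **`ε·(2δ)⁸ ≤ K · n⁸ · |Cov_{T,β,L}(A_x, A_y)|`**. [folklore] -/
theorem n8_floor_of_q2Floor (a : ℝ → ℝ) (ha : ∀ β, 0 < a β) (ha0 : Tendsto a atTop (𝓝 0))
    {v : 𝓢(EuclideanSpace ℝ (Fin 4), ℝ)} {δ σ : ℝ} (hδ : 0 ≤ δ)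
    (hvδ : ∀ y : EuclideanSpace ℝ (Fin 4), v y ≠ 0 → δ ≤ y 0)
    (hvσ : tsupport (v : EuclideanSpace ℝ (Fin 4) → ℝ) ⊆ Metric.closedBall 0 σ) {ε β₅ Λ₅ : ℝ} (hε : 0 < ε)
    (hfloor : ∀ β : ℝ, β₅ ≤ β → ∀ L : ℕ, Λ₅ ≤ a β * L → ε ≤ Q2 G r β L (a β) (thetaTest 4 v) v)
    {K : ℝ} (hK : (∫ y, |v y|) ^ 2 < K) :
    ∃ β₆ : ℝ, ∀ β : ℝ, β₆ ≤ β → ∀ L : ℕ, max Λ₅ σ ≤ a β * L →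
      ∃ x ∈ box 4 L, ∃ y ∈ box 4 L, thetaTest 4 v (a β • siteToE x) ≠ 0 ∧ v (a β • siteToE y) ≠ 0 ∧
        2 * δ ≤ a β * ‖siteToE (y - x)‖ ∧ a β * ‖siteToE (y - x)‖ ≤ 2 * σ ∧
        ε * (2 * δ) ^ 8 ≤ K * (‖siteToE (y - x)‖ ^ 8 *
          |torusE G r β L (fun U => dens G r x U * dens G r y U) -
            torusE G r β L (dens G r x) * torusE G r β L (dens G r y)|) := by
  have hθσ := tsupport_thetaTest_subset_closedBall_zero hvσ
  -- reference boxes `L₁ β = ⌈σ/aβ⌉₊` cover the supports; the envelope sums on any covering box equal those on `L₁ β`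
  set L₁ : ℝ → ℕ := fun β => ⌈σ / a β⌉₊ with hL₁
  have hL₁σ : ∀ β, σ ≤ a β * L₁ β := fun β => by
    have h1 : σ / a β ≤ L₁ β := Nat.le_ceil _
    calc σ = a β * (σ / a β) := by field_simp [(ha β).ne']
      _ ≤ a β * L₁ β := mul_le_mul_of_nonneg_left h1 (ha β).le
  have hcov : ∀ β (L : ℕ), σ ≤ a β * L → L₁ β ≤ L := fun β L hL => by
    refine Nat.ceil_le.2 ?_
    rw [div_le_iff₀ (ha β), mul_comm]
    exact hL
  have hlim := ((CeilingPrice.tendsto_envelope_thetaTest v hvσ a L₁ ha ha0 (Eventually.of_forall hL₁σ)).mul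
    (CeilingPrice.tendsto_envelope v hvσ a L₁ ha ha0 (Eventually.of_forall hL₁σ)))
  have e : (∫ y, |v y|) * (∫ y, |v y|) = (∫ y, |v y|) ^ 2 := by ring
  rw [e] at hlim
  obtain ⟨β₆, hβ₆⟩ := ((hlim.eventually (gt_mem_nhds hK)).and (eventually_ge_atTop β₅)).exists_forall_of_atTop
  refine ⟨β₆, fun β hβ L hL => ?_⟩
  obtain ⟨hPK, hβ5⟩ := hβ₆ β hβ
  have hΛ : Λ₅ ≤ a β * L := (le_max_left _ _).trans hL
  have hσL : σ ≤ a β * L := (le_max_right _ _).trans hL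
  obtain ⟨x, hx, y, hy, hfx, hgy, hgap, hle⟩ :=
    n8_floor_of_le_Q2 G r β L (ha β) hδ hvδ hε (hfloor β hβ5 L hΛ)
  refine ⟨x, hx, y, hy, hfx, hgy, hgap, mul_norm_le_of_charged (ha β) hθσ hvσ hfx hgy, hle.trans ?_⟩
  -- the envelope product on `box L` equals that on `box (L₁ β)`, which is `< K`
  have hθeq := CeilingPrice.sum_box_eq_sum_box_of_cover (φ := fun u => |thetaTest 4 v u|) (ha β)
    (CeilingPrice.tsupport_abs_subset hθσ) (hL₁σ β) (hcov β L hσL)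
  have hveq := CeilingPrice.sum_box_eq_sum_box_of_cover (φ := fun u => |v u|) (ha β)
    (CeilingPrice.tsupport_abs_subset hvσ) (hL₁σ β) (hcov β L hσL)
  rw [hθeq, hveq]
  exact mul_le_mul_of_nonneg_right hPK.le (by positivity)

end UnitMap

/-! ## §4 The converse for bumps: a pointwise `a⁸`-floor on the cloud gives clause (i) -/

section Converse

variable (G : Type) [Group G] [TopologicalSpace G] [IsTopologicalGroup G] [CompactSpace G]
  [MeasurableSpace G] [BorelSpace G] (r : LatticeRep G)

/-- **One torus: a pointwise floor on the charged cloud of a non-negative pair gives a smeared floor.**  If `f, g ≥ 0` and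
every charged pair has `c ≤ Cov_T(A_x, A_y)`, then `c · S_f S_g ≤ Q2_{β,L,s}(f, g)`. [folklore] -/
theorem q2_ge_of_pointwise_floor_at (β : ℝ) (L : ℕ) (s : ℝ) {f g : 𝓢(EuclideanSpace ℝ (Fin 4), ℝ)}
    (hf : ∀ u, 0 ≤ f u) (hg : ∀ u, 0 ≤ g u) {c : ℝ}
    (hc : ∀ x ∈ box 4 L, ∀ y ∈ box 4 L, f (s • siteToE x) ≠ 0 → g (s • siteToE y) ≠ 0 →
      c ≤ torusE G r β L (fun U => dens G r x U * dens G r y U) - torusE G r β L (dens G r x) * torusE G r β L (dens G r y)) :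
    c * ((∑ x ∈ box 4 L, f (s • siteToE x)) * (∑ y ∈ box 4 L, g (s • siteToE y))) ≤ Q2 G r β L s f g := by
  unfold Q2
  rw [Finset.sum_mul_sum, Finset.mul_sum]
  refine Finset.sum_le_sum fun x hx => ?_
  rw [Finset.mul_sum]
  refine Finset.sum_le_sum fun y hy => ?_
  by_cases hfx : f (s • siteToE x) = 0
  · simp [hfx]
  by_cases hgy : g (s • siteToE y) = 0
  · simp [hgy]
  have hw : 0 ≤ f (s • siteToE x) * g (s • siteToE y) := mul_nonneg (hf _) (hg _)
  calc c * (f (s • siteToE x) * g (s • siteToE y)) = f (s • siteToE x) * g (s • siteToE y) * c := by ring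
    _ ≤ f (s • siteToE x) * g (s • siteToE y) * _ := mul_le_mul_of_nonneg_left (hc x hx y hy hfx hgy) hw

/-- The time reflection of a non-negative test function is non-negative. [folklore] -/
theorem thetaTest_nonneg {v : 𝓢(EuclideanSpace ℝ (Fin 4), ℝ)} (hv : ∀ u, 0 ≤ v u) (u : EuclideanSpace ℝ (Fin 4)) :
    0 ≤ thetaTest 4 v u := by
  rw [thetaTest_apply]; exact hv _

/-- **Clause (i) from a pointwise `a⁸`-floor on the cloud (bump witnesses).**  Let `a > 0`, `a → 0`, `v ≥ 0` with
`‖v‖₁ > 0` and support in the ball of radius `σ`.  If for `β ≥ β₆`, on all tori with `Λ₆ ≤ aβ·L`, every pair charged by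
`θv, v` has `c·a(β)⁸ ≤ Cov_{T,β,L}(A_x, A_y)` (`c > 0`), then the plain clause-(i) floor holds:
`∃ ε > 0, β₅, Λ₅: ∀ β ≥ β₅ ∀ L, Λ₅ ≤ aβ·L → ε ≤ Q2_{β,L,aβ}(θv, v)` (with `ε = c‖v‖₁²/2`). [folklore] -/
theorem q2Floor_of_pointwise_floor (a : ℝ → ℝ) (ha : ∀ β, 0 < a β) (ha0 : Tendsto a atTop (𝓝 0))
    {v : 𝓢(EuclideanSpace ℝ (Fin 4), ℝ)} {σ : ℝ} (hv : ∀ u, 0 ≤ v u) (hv1 : 0 < ∫ y, |v y|)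
    (hvσ : tsupport (v : EuclideanSpace ℝ (Fin 4) → ℝ) ⊆ Metric.closedBall 0 σ) {c β₆ Λ₆ : ℝ} (hc : 0 < c)
    (hcloud : ∀ β : ℝ, β₆ ≤ β → ∀ L : ℕ, Λ₆ ≤ a β * L → ∀ x ∈ box 4 L, ∀ y ∈ box 4 L,
      thetaTest 4 v (a β • siteToE x) ≠ 0 → v (a β • siteToE y) ≠ 0 →
        c * a β ^ 8 ≤ torusE G r β L (fun U => dens G r x U * dens G r y U) -
          torusE G r β L (dens G r x) * torusE G r β L (dens G r y)) :
    ∃ ε β₅ Λ₅ : ℝ, 0 < ε ∧ ∀ β : ℝ, β₅ ≤ β → ∀ L : ℕ, Λ₅ ≤ a β * L → ε ≤ Q2 G r β L (a β) (thetaTest 4 v) v := by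
  have hθσ := tsupport_thetaTest_subset_closedBall_zero hvσ
  set L₁ : ℝ → ℕ := fun β => ⌈σ / a β⌉₊ with hL₁
  have hL₁σ : ∀ β, σ ≤ a β * L₁ β := fun β => by
    have h1 : σ / a β ≤ L₁ β := Nat.le_ceil _
    calc σ = a β * (σ / a β) := by field_simp [(ha β).ne']
      _ ≤ a β * L₁ β := mul_le_mul_of_nonneg_left h1 (ha β).le
  have hcov : ∀ β (L : ℕ), σ ≤ a β * L → L₁ β ≤ L := fun β L hL => by
    refine Nat.ceil_le.2 ?_
    rw [div_le_iff₀ (ha β), mul_comm]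
    exact hL
  have hlim := ((CeilingPrice.tendsto_envelope_thetaTest v hvσ a L₁ ha ha0 (Eventually.of_forall hL₁σ)).mul
    (CeilingPrice.tendsto_envelope v hvσ a L₁ ha ha0 (Eventually.of_forall hL₁σ)))
  have hhalf : (∫ y, |v y|) * (∫ y, |v y|) / 2 < (∫ y, |v y|) * (∫ y, |v y|) := by
    have : 0 < (∫ y, |v y|) * (∫ y, |v y|) := mul_pos hv1 hv1
    linarith
  obtain ⟨β₅, hβ₅⟩ := ((hlim.eventually (lt_mem_nhds hhalf)).and (eventually_ge_atTop β₆)).exists_forall_of_atTop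
  refine ⟨c * ((∫ y, |v y|) * (∫ y, |v y|) / 2), β₅, max Λ₆ σ, by positivity, fun β hβ L hL => ?_⟩
  obtain ⟨hP, hβ6⟩ := hβ₅ β hβ
  have hΛ : Λ₆ ≤ a β * L := (le_max_left _ _).trans hL
  have hσL : σ ≤ a β * L := (le_max_right _ _).trans hL
  have hq := q2_ge_of_pointwise_floor_at G r β L (a β) (thetaTest_nonneg hv) hv (hcloud β hβ6 L hΛ)
  -- envelope sums: drop the absolute values (non-negative witnesses), move to the reference box, compare with the limit
  have hθabs : ∑ x ∈ box 4 L, thetaTest 4 v (a β • siteToE x) = ∑ x ∈ box 4 L, |thetaTest 4 v (a β • siteToE x)| :=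
    Finset.sum_congr rfl fun x _ => (abs_of_nonneg (thetaTest_nonneg hv _)).symm
  have hvabs : ∑ y ∈ box 4 L, v (a β • siteToE y) = ∑ y ∈ box 4 L, |v (a β • siteToE y)| :=
    Finset.sum_congr rfl fun y _ => (abs_of_nonneg (hv _)).symm
  have hθeq := CeilingPrice.sum_box_eq_sum_box_of_cover (φ := fun u => |thetaTest 4 v u|) (ha β)
    (CeilingPrice.tsupport_abs_subset hθσ) (hL₁σ β) (hcov β L hσL)
  have hveq := CeilingPrice.sum_box_eq_sum_box_of_cover (φ := fun u => |v u|) (ha β)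
    (CeilingPrice.tsupport_abs_subset hvσ) (hL₁σ β) (hcov β L hσL)
  rw [hθabs, hvabs, hθeq, hveq] at hq
  have ha8 : 0 < a β ^ 8 := pow_pos (ha β) 8
  have e : c * a β ^ 8 * ((∑ x ∈ box 4 (L₁ β), |thetaTest 4 v (a β • siteToE x)|) *
      (∑ y ∈ box 4 (L₁ β), |v (a β • siteToE y)|)) =
      c * ((a β ^ 4 * ∑ x ∈ box 4 (L₁ β), |thetaTest 4 v (a β • siteToE x)|) *
        (a β ^ 4 * ∑ y ∈ box 4 (L₁ β), |v (a β • siteToE y)|)) := by ring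
  rw [e] at hq
  refine le_trans ?_ hq
  exact mul_le_mul_of_nonneg_left hP.le hc.le

end Converse

end Summit.QuantumFields.YangMills.Cruxes.NT.PointwiseFloor

end
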